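import Literature.Analysis.FunctionSpaces.PotentialDynamics
import Mathlib.MeasureTheory.Function.JacobianOneDim
import Mathlib.Analysis.SpecialFunctions.Sqrt
import Mathlib.Analysis.SpecialFunctions.Trigonometric.InverseDeriv
import Mathlib.MeasureTheory.Integral.IntervalIntegral.FundThmCalculus
import Mathlib.Analysis.Calculus.LocalExtr.Basic
import Mathlib.Analysis.Calculus.FDeriv.Measurable
import HarnessLib

/-!
# Monotonicity of the half-deflection `Θ(ℰ₀, ·)` — discharge of `strictMonoOn_halfDeflection`

Topic `Literature/Analysis/FunctionSpaces`, sibling proofs file of `PotentialDynamics.lean`. That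
file vendors, for a short-range repulsive potential `Φ` (radial profile `φ`), the named fact
`Literature.Analysis.FunctionSpaces.ShortRangePotential.strictMonoOn_halfDeflection Φ`
(Gallagher–Saint-Raymond–Texier 2013, Part III Ch. 8 Lemma 3.1 "due to Pulvirenti, Saffirio and
Simonella"; Pulvirenti–Saffirio–Simonella 2014, Appendix item 2): if `φ' ≠ 0` on `(0, 1)`
(`IsStrictlyRepulsive`) and `ρ φ''(ρ) + 2 φ'(ρ) ≥ 0` on `(0, 1)` (`PSSCondition`, GST (8.3.1)), then
for every `ℰ₀ > 0` the half-deflection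
`Θ(ℰ₀, 𝒥₀) = arcsin 𝒥₀ + 𝒥₀ ∫_{ρ_*}^1 dρ / (ρ² √(1 - 4φ(ρ)/ℰ₀ - 𝒥₀²/ρ²))`
(`ShortRangePotential.halfDeflection`, turning radius `ρ_* = ShortRangePotential.turningRadius`)
is strictly increasing in the impact parameter `𝒥₀ ∈ [0, 1)`. Here it is **proved**:

* `ShortRangePotential.strictMonoOn_halfDeflection_holds Φ : Φ.strictMonoOn_halfDeflection`
  (**discharge**), whence the monotone-deflection hypothesis of GST 2013 Theorem 5 /
  `exists_hasCrossSection` only depends on the remaining named fact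
  `deflectionAngle_eq_pi_sub_two_mul_halfDeflection` (the identification of the scattering angle
  with `π - 2Θ`, GST Ch. 8 §1): `ShortRangePotential.hasMonotoneDeflection_of_pssCondition_of'`
  and `ShortRangePotential.HasMonotoneDeflection.of_pssCondition'`.

## The proof

GST 2013 (proof of Lemma 3.1) and PSS 2014 (Appendix, following Desvillettes–Pulvirenti 1999)
substitute `sin² ϕ = 4φ(ρ)/ℰ₀ + 𝒥₀²/ρ²`, which removes the inverse-square-root singularity of
the integrand at the turning point, and then differentiate the resulting integral with respect
to `𝒥₀`; the sign of `∂Θ/∂𝒥₀` is read off from the bracket `ρ φ'' + 2 φ' + ρ³ (φ')² / (ℰ₀ 𝒥₀²)`.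
We formalise the same substitution but replace the differentiation under the integral sign by a
*pointwise* comparison, which is what the printed bracket expresses. Write `u = 4φ/ℰ₀`,
`R_J(ρ) = 1 - u(ρ) - J²/ρ²` (the radicand; `R_J(ρ_*) = 0`, `R_J` strictly increasing on
`(0, ∞)`), `T_J = √(1 - J²)` and `t = √(R_J(ρ))` (`= cos ϕ`). By the one-dimensional
change-of-variables formula for monotone maps
(`MeasureTheory.integral_Icc_deriv_smul_of_deriv_nonneg`, no integrability hypothesis needed)

`Θ(ℰ₀, J) = arcsin J + ∫_0^{T_J} K_J(σ_J(t)) dt`, `K_J(ρ) = 2J / (ρ² R_J'(ρ))`,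

where `σ_J` inverts `ρ ↦ √(R_J(ρ))` on `[ρ_*, 1]` (`halfDeflection_eq_integral`). At the common
"level" `s = 1 - t²` one has `s - u(ρ) = J²/ρ²` for `ρ = σ_J(t)`, and then
`K_J(ρ) = 2 / m_s(ρ)` with the PSS auxiliary function
`m_s(r) = (2 a(r) + r a'(r)) / √(a(r))`, `a = s - u` (`kernel_eq_two_div_pssAux`). Its derivative
is `(2a (2a' + r a'') - r a'²) / (2 a √a)` (`hasDerivAt_pssAux`), and `2a' + r a'' =
-(4/ℰ₀)(2φ' + ρ φ'') ≤ 0` is exactly the PSS condition: `m_s` is nonincreasing on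
`{r > 0 | u(r) < s}` and strictly decreasing on its part below `1` when `φ' ≠ 0` there
(`antitoneOn_pssAux_level`, `strictAntiOn_pssAux_level`); since `m_s(1) = 2√s` this gives
`0 < K_J(σ_J t) ≤ 1/√(1 - t²)` (`kernel_pos_le`), and for `J₁ < J₂` at the same `t` the radii
satisfy `σ_{J₁}(t) < σ_{J₂}(t)`, whence `K_{J₁}(σ_{J₁} t) < K_{J₂}(σ_{J₂} t)`
(`kernel_lt_kernel`). Finally
`Θ(J₂) - Θ(J₁) = ∫_0^{T_{J₂}} (k₂ - k₁) + ∫_{T_{J₂}}^{T_{J₁}} (1/√(1-t²) - k₁) > 0`, using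
`arcsin J₂ - arcsin J₁ = ∫_{T_{J₂}}^{T_{J₁}} dt/√(1-t²)` (`intervalIntegral_one_div_sqrt_one_sub_sq`);
the case `J₁ = 0` is `Θ(ℰ₀, 0) = 0 < arcsin J₂ ≤ Θ(ℰ₀, J₂)`. As a by-product the improper integral
defining `Θ` is a convergent Lebesgue integral whenever `0 < J < 1` (it equals a bounded
integrand's integral after the substitution), so no junk value of `halfDeflection` is involved.

All auxiliary statements are written with explicit expressions (no new definitions), inside the
namespace `Literature.Analysis.FunctionSpaces.ShortRangePotential`.

## What is not here

The other named fact feeding `hasMonotoneDeflection_of_pssCondition`,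
`deflectionAngle_eq_pi_sub_two_mul_halfDeflection` (GST 2013 Ch. 8 §1, Lemma 1.2: the scattering
solution of `ÿ = -2∇Φ(y)` is planar, reaches `ρ_*` once and leaves the range with deflection
`π - 2Θ`), requires the existence/uniqueness/asymptotics theory of the scattering ODE behind
`outVelocity` and is left as a named fact.

## References

* I. Gallagher, L. Saint-Raymond, B. Texier, *From Newton to Boltzmann: hard spheres and
  short-range potentials*, arXiv:1208.5753v3 / EMS ZLAM (2013), Part III Ch. 8 §1 (Lemma 1.2,
  (theta)), §3.1 (definition of `Θ`, Lemma 3.1, condition (8.3.1), Remark 3.2).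
  [GallagherSaintraymondTexier2012]
* M. Pulvirenti, C. Saffirio, S. Simonella, *On the validity of the Boltzmann equation for short
  range potentials*, Rev. Math. Phys. 26 (2014), Appendix (formula for `Θ(ρ)`, the substitutions
  `y = ρ/r`, `sin² ϕ = 2Φ(ρ/y)/V² + y²`, formula for `dΘ/dρ`, items 1–3).
  [PulvirentiSaffirioSimonella2014]
-/

open MeasureTheory Set Filter Topology

namespace Literature.Analysis.FunctionSpaces

namespace ShortRangePotential


/-! ### The PSS auxiliary function -/

/-- **Derivative of the PSS auxiliary function.** For `a > 0` at `r`, with `a'` a derivative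
function of `a` at `r` and `a''` the derivative of `a'` at `r`, the function
`m(x) = (2 a(x) + x a'(x)) / √(a(x))` has derivative `(2 a (2 a' + r a'') - r a'²) / (2 a √a)`
at `r` (PSS 2014 Appendix, the bracket of formula (dΘ/dρ); GST 2013 Ch. 8, proof of Lemma 3.1).
[cite: PulvirentiSaffirioSimonella2014, Appendix, formula for dΘ/dρ] -/
theorem hasDerivAt_pssAux {a a' : ℝ → ℝ} {a'' r : ℝ} (hpos : 0 < a r)
    (ha : HasDerivAt a (a' r) r) (ha' : HasDerivAt a' a'' r) :
    HasDerivAt (fun x => (2 * a x + x * a' x) / Real.sqrt (a x))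
      ((2 * a r * (2 * a' r + r * a'') - r * a' r ^ 2) / (2 * a r * Real.sqrt (a r))) r := by
  have hS : 0 < Real.sqrt (a r) := Real.sqrt_pos.mpr hpos
  have hS2 : Real.sqrt (a r) ^ 2 = a r := Real.sq_sqrt hpos.le
  have hN : HasDerivAt (fun x => 2 * a x + x * a' x) (2 * a' r + (1 * a' r + r * a'')) r :=
    (ha.const_mul 2).add ((hasDerivAt_id r).mul ha')
  have hQ : HasDerivAt (fun x => Real.sqrt (a x)) (a' r / (2 * Real.sqrt (a r))) r :=
    ha.sqrt hpos.ne'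
  refine (hN.div hQ hS.ne').congr_deriv ?_
  field_simp
  rw [hS2]
  ring

/-- If `2 a' + r a'' ≤ 0` on a convex open set `D ⊆ [0, ∞)` on which `a > 0`, the PSS
auxiliary function `(2 a + r a') / √a` is nonincreasing on `D` (its derivative
`(2a(2a' + ra'') - r a'²)/(2a√a)` is `≤ 0`). [cite: PulvirentiSaffirioSimonella2014, Appendix, item 2] -/
theorem antitoneOn_pssAux {a a' a'' : ℝ → ℝ} {D : Set ℝ} (hD : Convex ℝ D) (hDo : IsOpen D)
    (hD0 : ∀ r ∈ D, 0 ≤ r) (hpos : ∀ r ∈ D, 0 < a r)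
    (ha : ∀ r ∈ D, HasDerivAt a (a' r) r) (ha' : ∀ r ∈ D, HasDerivAt a' (a'' r) r)
    (hsign : ∀ r ∈ D, 2 * a' r + r * a'' r ≤ 0) :
    AntitoneOn (fun x => (2 * a x + x * a' x) / Real.sqrt (a x)) D := by
  have hder : ∀ r ∈ D, HasDerivAt (fun x => (2 * a x + x * a' x) / Real.sqrt (a x))
      ((2 * a r * (2 * a' r + r * a'' r) - r * a' r ^ 2) / (2 * a r * Real.sqrt (a r))) r :=
    fun r hr => hasDerivAt_pssAux (hpos r hr) (ha r hr) (ha' r hr)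
  refine antitoneOn_of_hasDerivWithinAt_nonpos hD
    (f' := fun r => (2 * a r * (2 * a' r + r * a'' r) - r * a' r ^ 2) /
      (2 * a r * Real.sqrt (a r)))
    (fun r hr => (hder r hr).continuousAt.continuousWithinAt) ?_ ?_
  · rw [hDo.interior_eq]
    exact fun r hr => (hder r hr).hasDerivWithinAt
  · rw [hDo.interior_eq]
    intro r hr
    have h1 : 2 * a r * (2 * a' r + r * a'' r) ≤ 0 :=
      mul_nonpos_of_nonneg_of_nonpos (by linarith [hpos r hr]) (hsign r hr)
    have h2 : 0 ≤ r * a' r ^ 2 := mul_nonneg (hD0 r hr) (sq_nonneg _)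
    have h3 : 0 < 2 * a r * Real.sqrt (a r) :=
      mul_pos (by linarith [hpos r hr]) (Real.sqrt_pos.mpr (hpos r hr))
    exact div_nonpos_iff.mpr (Or.inr ⟨by linarith, h3.le⟩)

/-- If moreover `D ⊆ (0, ∞)` and `a' ≠ 0` on `D`, the PSS auxiliary function `(2 a + r a') / √a`
is strictly decreasing on `D`. [cite: PulvirentiSaffirioSimonella2014, Appendix, item 2] -/
theorem strictAntiOn_pssAux {a a' a'' : ℝ → ℝ} {D : Set ℝ} (hD : Convex ℝ D) (hDo : IsOpen D)
    (hD0 : ∀ r ∈ D, 0 < r) (hpos : ∀ r ∈ D, 0 < a r)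
    (ha : ∀ r ∈ D, HasDerivAt a (a' r) r) (ha' : ∀ r ∈ D, HasDerivAt a' (a'' r) r)
    (hsign : ∀ r ∈ D, 2 * a' r + r * a'' r ≤ 0) (hne : ∀ r ∈ D, a' r ≠ 0) :
    StrictAntiOn (fun x => (2 * a x + x * a' x) / Real.sqrt (a x)) D := by
  have hder : ∀ r ∈ D, HasDerivAt (fun x => (2 * a x + x * a' x) / Real.sqrt (a x))
      ((2 * a r * (2 * a' r + r * a'' r) - r * a' r ^ 2) / (2 * a r * Real.sqrt (a r))) r :=
    fun r hr => hasDerivAt_pssAux (hpos r hr) (ha r hr) (ha' r hr)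
  refine strictAntiOn_of_hasDerivWithinAt_neg hD
    (f' := fun r => (2 * a r * (2 * a' r + r * a'' r) - r * a' r ^ 2) /
      (2 * a r * Real.sqrt (a r)))
    (fun r hr => (hder r hr).continuousAt.continuousWithinAt) ?_ ?_
  · rw [hDo.interior_eq]
    exact fun r hr => (hder r hr).hasDerivWithinAt
  · rw [hDo.interior_eq]
    intro r hr
    have h1 : 2 * a r * (2 * a' r + r * a'' r) ≤ 0 :=
      mul_nonpos_of_nonneg_of_nonpos (by linarith [hpos r hr]) (hsign r hr)
    have h2 : 0 < r * a' r ^ 2 := mul_pos (hD0 r hr) (sq_pos_of_ne_zero (hne r hr))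
    have h3 : 0 < 2 * a r * Real.sqrt (a r) :=
      mul_pos (by linarith [hpos r hr]) (Real.sqrt_pos.mpr (hpos r hr))
    exact div_neg_of_neg_of_pos (by linarith) h3

variable {d : Type*} (Φ : ShortRangePotential d)

/-- The profile of a short-range potential is continuous on `(0, ∞)`. [folklore] -/
theorem continuousOn_φ : ContinuousOn Φ.φ (Ioi 0) := Φ.contDiffOn.continuousOn

/-- The profile is differentiable on `(0, ∞)` with derivative `deriv φ`. [folklore] -/
theorem hasDerivAt_φ {r : ℝ} (hr : 0 < r) : HasDerivAt Φ.φ (deriv Φ.φ r) r :=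
  ((Φ.differentiableOn_deriv_φ.1 r hr).differentiableAt (Ioi_mem_nhds hr)).hasDerivAt

/-- The derivative of the profile is differentiable on `(0, ∞)` (`φ` is `C²` there). [folklore] -/
theorem hasDerivAt_deriv_φ {r : ℝ} (hr : 0 < r) :
    HasDerivAt (deriv Φ.φ) (deriv (deriv Φ.φ) r) r :=
  ((Φ.differentiableOn_deriv_φ.2 r hr).differentiableAt (Ioi_mem_nhds hr)).hasDerivAt

/-- Outside the range the force vanishes: `φ'(r) = 0` for `1 ≤ r` (`φ ≥ 0` has a minimum at every
such `r`, where `φ r = 0`; in particular `φ'(1) = 0`, the clause making the boundary term of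
PSS's formula (dΘ/dρ) vanish). [folklore] -/
theorem deriv_φ_eq_zero_of_one_le {r : ℝ} (hr : 1 ≤ r) : deriv Φ.φ r = 0 := by
  apply IsLocalMin.deriv_eq_zero
  refine Filter.Eventually.of_forall fun x => ?_
  rw [Φ.eq_zero_of_one_le r hr]
  exact Φ.nonneg x

/-- `φ''(r) = 0` for `1 ≤ r`: `φ' ≤ 0` on `(0, ∞)` has a maximum at every such `r`. [folklore] -/
theorem deriv_deriv_φ_eq_zero_of_one_le {r : ℝ} (hr : 1 ≤ r) : deriv (deriv Φ.φ) r = 0 := by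
  apply IsLocalMax.deriv_eq_zero
  show ∀ᶠ x in 𝓝 r, deriv Φ.φ x ≤ deriv Φ.φ r
  filter_upwards [Ioi_mem_nhds (zero_lt_one.trans_le hr)] with x hx
  rw [Φ.deriv_φ_eq_zero_of_one_le hr]
  exact Φ.deriv_φ_nonpos hx

/-- The PSS condition `ρ φ'' + 2 φ' ≥ 0`, assumed on `(0, 1)`, holds on all of `(0, ∞)`
(both derivatives vanish on `[1, ∞)`). [cite: GallagherSaintraymondTexier2012, Part III Ch. 8 §3.1, condition (8.3.1)] -/
theorem pss_sign (hΦ : Φ.PSSCondition) {r : ℝ} (hr : 0 < r) :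
    0 ≤ r * deriv (deriv Φ.φ) r + 2 * deriv Φ.φ r := by
  rcases lt_or_ge r 1 with h | h
  · exact hΦ r ⟨hr, h⟩
  · rw [Φ.deriv_φ_eq_zero_of_one_le h, Φ.deriv_deriv_φ_eq_zero_of_one_le h]
    simp

/-! ### The radicand `R(ρ) = 1 - 4φ(ρ)/E₀ - J²/ρ²` -/

/-- The radicand `R_J(ρ) = 1 - 4φ(ρ)/ℰ₀ - J²/ρ²` (`= (ℰ₀ - Ψ)/ℰ₀` with GST's effective potential
`Ψ`) is continuous on `(0, ∞)`. [folklore] -/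
theorem continuousOn_radicand (E₀ J : ℝ) :
    ContinuousOn (fun ρ => 1 - 4 * Φ.φ ρ / E₀ - J ^ 2 / ρ ^ 2) (Ioi 0) := by
  refine ((continuousOn_const.sub ((continuousOn_const.mul Φ.continuousOn_φ).div_const _)).sub
    (continuousOn_const.div (continuousOn_pow 2) fun x hx => ?_))
  exact pow_ne_zero 2 (ne_of_gt hx)

/-- The radicand has derivative `R_J'(ρ) = 2J²/ρ³ - 4φ'(ρ)/ℰ₀` on `(0, ∞)`
(GST 2013 Ch. 8 §2, proof of the scattering-time bound: `d/dρ (ℰ₀ - Ψ) = 2ℰ₀𝒥₀²/ρ³ - 4Φ'`). [folklore] -/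
theorem hasDerivAt_radicand (E₀ J : ℝ) {ρ : ℝ} (hρ : 0 < ρ) :
    HasDerivAt (fun ρ => 1 - 4 * Φ.φ ρ / E₀ - J ^ 2 / ρ ^ 2)
      (2 * J ^ 2 / ρ ^ 3 - 4 * deriv Φ.φ ρ / E₀) ρ := by
  have h1 : HasDerivAt (fun ρ => 4 * Φ.φ ρ / E₀) (4 * deriv Φ.φ ρ / E₀) ρ :=
    ((Φ.hasDerivAt_φ hρ).const_mul 4).div_const E₀
  have h2 : HasDerivAt (fun ρ => J ^ 2 / ρ ^ 2)
      ((0 * ρ ^ 2 - J ^ 2 * (↑(2 : ℕ) * ρ ^ (2 - 1))) / (ρ ^ 2) ^ 2) ρ :=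
    (hasDerivAt_const ρ (J ^ 2)).div (hasDerivAt_pow 2 ρ) (pow_ne_zero 2 hρ.ne')
  refine (((hasDerivAt_const ρ (1 : ℝ)).sub h1).sub h2).congr_deriv ?_
  push_cast
  field_simp
  ring

/-- For `J ≠ 0` and `ℰ₀ > 0` the radicand is strictly increasing on `(0, ∞)` ("`Ψ` is increasing
as `ρ` is decreasing", GST 2013 Ch. 8, proof of Lemma 1.2). [folklore] -/
theorem strictMonoOn_radicand {E₀ J : ℝ} (hE : 0 < E₀) (hJ : J ≠ 0) :
    StrictMonoOn (fun ρ => 1 - 4 * Φ.φ ρ / E₀ - J ^ 2 / ρ ^ 2) (Ioi 0) := by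
  intro x hx y hy hxy
  have h1 : Φ.φ y ≤ Φ.φ x := Φ.antitoneOn hx hy hxy.le
  have h2 : J ^ 2 / y ^ 2 < J ^ 2 / x ^ 2 := by
    apply div_lt_div_of_pos_left (sq_pos_of_ne_zero hJ) (pow_pos hx.out 2)
    exact pow_lt_pow_left₀ hxy hx.out.le two_ne_zero
  have h3 : 4 * Φ.φ y / E₀ ≤ 4 * Φ.φ x / E₀ :=
    div_le_div_of_nonneg_right (by linarith) hE.le
  dsimp only
  linarith

/-- The radicand decreases with the impact parameter: `R_{J₂} < R_{J₁}` pointwise for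
`0 ≤ J₁ < J₂`. [folklore] -/
theorem radicand_lt_radicand {E₀ J₁ J₂ : ℝ} (hJ₁ : 0 ≤ J₁) (h : J₁ < J₂) {ρ : ℝ} (hρ : 0 < ρ) :
    1 - 4 * Φ.φ ρ / E₀ - J₂ ^ 2 / ρ ^ 2 < 1 - 4 * Φ.φ ρ / E₀ - J₁ ^ 2 / ρ ^ 2 := by
  have : J₁ ^ 2 / ρ ^ 2 < J₂ ^ 2 / ρ ^ 2 := by
    apply div_lt_div_of_pos_right _ (by positivity)
    exact pow_lt_pow_left₀ h hJ₁ two_ne_zero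
  linarith

/-- At the edge of the range the radicand is `1 - J²` (`φ(1) = 0`). [folklore] -/
theorem radicand_one (E₀ J : ℝ) : 1 - 4 * Φ.φ 1 / E₀ - J ^ 2 / 1 ^ 2 = 1 - J ^ 2 := by
  simp [Φ.eq_zero_of_one_le 1 le_rfl]

/-- **The turning radius** (GST 2013 Ch. 8 Lemma 1.2): for `ℰ₀ > 0` and `0 < J < 1` the set
`{ρ ∈ (0,1) | Ψ(ρ) = ℰ₀}` is the singleton `{ρ_*}` of the unique zero of the radicand, so that
`turningRadius ℰ₀ J = ρ_*`, with `J ≤ ρ_* < 1` and `R_J(ρ_*) = 0`. (Existence by the intermediate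
value theorem on `[J, 1]`: `R_J(J) = -4φ(J)/ℰ₀ ≤ 0 < 1 - J² = R_J(1)`; uniqueness by strict
monotonicity.) [cite: GallagherSaintraymondTexier2012, Part III Ch. 8 §1, Lemma 1.2 (definition of ρ_*)] -/
theorem turningRadius_spec {E₀ J : ℝ} (hE : 0 < E₀) (hJ : 0 < J) (hJ1 : J < 1) :
    ∃ ρs : ℝ, Φ.turningRadius E₀ J = ρs ∧ J ≤ ρs ∧ ρs < 1 ∧
      1 - 4 * Φ.φ ρs / E₀ - J ^ 2 / ρs ^ 2 = 0 := by
  set R : ℝ → ℝ := fun ρ => 1 - 4 * Φ.φ ρ / E₀ - J ^ 2 / ρ ^ 2 with hR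
  have hcont : ContinuousOn R (Icc J 1) :=
    (Φ.continuousOn_radicand E₀ J).mono fun x hx => hJ.trans_le hx.1
  have hR1 : R 1 = 1 - J ^ 2 := Φ.radicand_one E₀ J
  have hRJ : R J ≤ 0 := by
    have : J ^ 2 / J ^ 2 = 1 := div_self (pow_ne_zero 2 hJ.ne')
    simp only [hR, this]
    have := div_nonneg (mul_nonneg (by norm_num : (0:ℝ) ≤ 4) (Φ.nonneg J)) hE.le
    linarith
  have hR1pos : 0 < R 1 := by rw [hR1]; nlinarith
  obtain ⟨ρs, hρs, hRρs⟩ : (0 : ℝ) ∈ R '' Icc J 1 :=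
    intermediate_value_Icc hJ1.le hcont ⟨hRJ, hR1pos.le⟩
  have hρs1 : ρs < 1 := by
    rcases hρs.2.lt_or_eq with h | h
    · exact h
    · exact absurd hRρs (by rw [h]; exact hR1pos.ne')
  have hmono := Φ.strictMonoOn_radicand hE hJ.ne'
  have hset : {ρ : ℝ | ρ ∈ Set.Ioo (0 : ℝ) 1 ∧ Φ.effectivePotential E₀ J ρ = E₀} = {ρs} := by
    ext ρ
    simp only [mem_setOf_eq, mem_singleton_iff, effectivePotential]
    constructor
    · rintro ⟨hρ, heq⟩
      have h4 : 4 * Φ.φ ρ / E₀ = 1 - J ^ 2 / ρ ^ 2 := by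
        rw [div_eq_iff hE.ne']
        have : 4 * Φ.φ ρ = E₀ - E₀ * J ^ 2 / ρ ^ 2 := by linarith
        rw [this]
        ring
      have hRρ : R ρ = 0 := by
        show 1 - 4 * Φ.φ ρ / E₀ - J ^ 2 / ρ ^ 2 = 0
        rw [h4]
        ring
      exact hmono.injOn hρ.1 (hJ.trans_le hρs.1) (hRρ.trans hRρs.symm)
    · rintro rfl
      refine ⟨⟨hJ.trans_le hρs.1, hρs1⟩, ?_⟩
      have h : 1 - 4 * Φ.φ ρ / E₀ - J ^ 2 / ρ ^ 2 = 0 := hRρs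
      have h4 : 4 * Φ.φ ρ / E₀ = 1 - J ^ 2 / ρ ^ 2 := by linarith
      have h5 : 4 * Φ.φ ρ = (1 - J ^ 2 / ρ ^ 2) * E₀ := (div_eq_iff hE.ne').mp h4
      rw [h5]
      ring
  refine ⟨ρs, ?_, hρs.1, hρs1, hRρs⟩
  rw [turningRadius, hset, csSup_singleton]


/-- **The substitution variable.** `f(ρ) = √(R_J(ρ))` is a continuous strictly increasing
bijection `[ρ_*, 1] → [0, √(1 - J²)]`; its inverse `σ` (here `Function.invFunOn`) is monotone on
`[0, √(1-J²)]`, satisfies `σ (f ρ) = ρ` on `[ρ_*, 1]`, and maps `(0, √(1-J²))` into `(ρ_*, 1)`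
with `R_J(σ t) = t²`. This is the change of variable `cos ϕ = √(1 - sin²ϕ)`,
`sin² ϕ = 4φ(ρ)/ℰ₀ + 𝒥₀²/ρ²` of GST 2013 (proof of Lemma 3.1) / PSS 2014 (Appendix). [folklore] -/
theorem exists_inverse_sqrt_radicand {E₀ J : ℝ} (hE : 0 < E₀) (hJ : 0 < J) (hJ1 : J < 1) :
    ∃ σ : ℝ → ℝ, MonotoneOn σ (Icc 0 (Real.sqrt (1 - J ^ 2))) ∧
      (∀ ρ ∈ Icc (Φ.turningRadius E₀ J) 1,
        σ (Real.sqrt (1 - 4 * Φ.φ ρ / E₀ - J ^ 2 / ρ ^ 2)) = ρ) ∧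
      (∀ t ∈ Ioo 0 (Real.sqrt (1 - J ^ 2)), σ t ∈ Ioo (Φ.turningRadius E₀ J) 1 ∧
        1 - 4 * Φ.φ (σ t) / E₀ - J ^ 2 / σ t ^ 2 = t ^ 2) := by
  obtain ⟨ρs, hts, hJρs, hρs1, hRρs⟩ := Φ.turningRadius_spec hE hJ hJ1
  rw [hts]
  have hρs0 : 0 < ρs := hJ.trans_le hJρs
  set R : ℝ → ℝ := fun ρ => 1 - 4 * Φ.φ ρ / E₀ - J ^ 2 / ρ ^ 2 with hR
  set f : ℝ → ℝ := fun ρ => Real.sqrt (R ρ) with hf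
  have hRmono : StrictMonoOn R (Ioi 0) := Φ.strictMonoOn_radicand hE hJ.ne'
  have hsub : Icc ρs 1 ⊆ Ioi 0 := fun x hx => hρs0.trans_le hx.1
  have hRnonneg : ∀ x ∈ Icc ρs 1, 0 ≤ R x := fun x hx =>
    hRρs.symm.le.trans (hRmono.monotoneOn hρs0 (hsub hx) hx.1)
  have hfmono : StrictMonoOn f (Icc ρs 1) := fun x hx y hy hxy =>
    Real.sqrt_lt_sqrt (hRnonneg x hx) (hRmono (hsub hx) (hsub hy) hxy)
  have hfcont : ContinuousOn f (Icc ρs 1) :=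
    ((Φ.continuousOn_radicand E₀ J).mono hsub).sqrt
  have hf0 : f ρs = 0 := by
    show Real.sqrt (R ρs) = 0
    rw [show R ρs = 0 from hRρs, Real.sqrt_zero]
  have hf1 : f 1 = Real.sqrt (1 - J ^ 2) := by
    simp only [hf, hR, Φ.radicand_one E₀ J]
  have himage : Icc 0 (Real.sqrt (1 - J ^ 2)) ⊆ f '' Icc ρs 1 := by
    rw [← hf0, ← hf1]
    exact intermediate_value_Icc hρs1.le hfcont
  refine ⟨Function.invFunOn f (Icc ρs 1), ?_, ?_, ?_⟩
  · intro t₁ ht₁ t₂ ht₂ h12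
    obtain ⟨h1m, h1e⟩ := (Function.invFunOn_pos (himage ht₁) : _ ∧ _)
    obtain ⟨h2m, h2e⟩ := (Function.invFunOn_pos (himage ht₂) : _ ∧ _)
    rw [← hfmono.le_iff_le h1m h2m, h1e, h2e]
    exact h12
  · intro ρ hρ
    exact hfmono.injOn.leftInvOn_invFunOn hρ
  · intro t ht
    obtain ⟨hm, he⟩ := (Function.invFunOn_pos (himage (Ioo_subset_Icc_self ht)) : _ ∧ _)
    set ρ := Function.invFunOn f (Icc ρs 1) t with hρ
    have hne0 : ρ ≠ ρs := by
      rintro h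
      rw [h, hf0] at he
      exact ht.1.ne he
    have hne1 : ρ ≠ 1 := by
      rintro h
      rw [h, hf1] at he
      exact ht.2.ne he.symm
    refine ⟨⟨lt_of_le_of_ne hm.1 (Ne.symm hne0), lt_of_le_of_ne hm.2 hne1⟩, ?_⟩
    have h2 : f ρ ^ 2 = R ρ := Real.sq_sqrt (hRnonneg ρ hm)
    rw [he] at h2
    exact h2.symm


/-- `R_J'(ρ) = 2J²/ρ³ - 4φ'(ρ)/ℰ₀ > 0` on `(0, ∞)` for `J ≠ 0` (repulsive potential). [folklore] -/
theorem radicandDeriv_pos {E₀ J : ℝ} (hE : 0 < E₀) (hJ : J ≠ 0) {x : ℝ} (hx : 0 < x) :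
    0 < 2 * J ^ 2 / x ^ 3 - 4 * deriv Φ.φ x / E₀ := by
  have h1 : 0 < 2 * J ^ 2 / x ^ 3 := div_pos (mul_pos two_pos (sq_pos_of_ne_zero hJ)) (pow_pos hx 3)
  have h2 : 4 * deriv Φ.φ x / E₀ ≤ 0 :=
    div_nonpos_iff.mpr (Or.inr ⟨by linarith [Φ.deriv_φ_nonpos hx], hE.le⟩)
  linarith

/-- **The half-deflection after the substitution `t = √(R_J(ρ))`**: for `ℰ₀ > 0`, `0 < J < 1`
and any left inverse `σ` of `ρ ↦ √(R_J(ρ))` on `[ρ_*, 1]`,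
`Θ(ℰ₀, J) = arcsin J + ∫_{[0, √(1-J²)]} 2J / (σ(t)² R_J'(σ t)) dt`
(GST 2013, proof of Ch. 8 Lemma 3.1: `Θ = arcsin 𝒥₀ + ∫ sin ϕ / (𝒥₀/ρ - 2ρΦ'/(ℰ₀𝒥₀)) dϕ`; PSS 2014
Appendix, formula after "to get"). Obtained from Mathlib's change-of-variables formula for
monotone maps `integral_Icc_deriv_smul_of_deriv_nonneg`, with
`f' · (2J/(ρ² R_J')) = J (ρ² √R_J)⁻¹` on `(ρ_*, 1]`. [cite: GallagherSaintraymondTexier2012, Part III Ch. 8 §3.1, proof of Lemma 3.1 (change of variable)] -/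
theorem halfDeflection_eq_integral {E₀ J : ℝ} (hE : 0 < E₀) (hJ : 0 < J) (hJ1 : J < 1)
    {σ : ℝ → ℝ} (hσ : ∀ ρ ∈ Icc (Φ.turningRadius E₀ J) 1,
        σ (Real.sqrt (1 - 4 * Φ.φ ρ / E₀ - J ^ 2 / ρ ^ 2)) = ρ) :
    Φ.halfDeflection E₀ J = Real.arcsin J +
      ∫ t in Icc 0 (Real.sqrt (1 - J ^ 2)),
        2 * J / (σ t ^ 2 * (2 * J ^ 2 / σ t ^ 3 - 4 * deriv Φ.φ (σ t) / E₀)) := by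
  obtain ⟨ρs, hts, hJρs, hρs1, hRρs⟩ := Φ.turningRadius_spec hE hJ hJ1
  rw [hts] at hσ
  rw [halfDeflection_apply, hts]
  have hρs0 : 0 < ρs := hJ.trans_le hJρs
  set R : ℝ → ℝ := fun ρ => 1 - 4 * Φ.φ ρ / E₀ - J ^ 2 / ρ ^ 2 with hR
  set R' : ℝ → ℝ := fun ρ => 2 * J ^ 2 / ρ ^ 3 - 4 * deriv Φ.φ ρ / E₀ with hR'
  set f : ℝ → ℝ := fun ρ => Real.sqrt (R ρ) with hf
  set f' : ℝ → ℝ := fun ρ => R' ρ / (2 * Real.sqrt (R ρ)) with hf'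
  set k : ℝ → ℝ := fun t => 2 * J / (σ t ^ 2 * R' (σ t)) with hk
  have hRmono : StrictMonoOn R (Ioi 0) := Φ.strictMonoOn_radicand hE hJ.ne'
  have hsub : Icc ρs 1 ⊆ Ioi 0 := fun x hx => hρs0.trans_le hx.1
  have hRpos : ∀ x ∈ Ioc ρs 1, 0 < R x := fun x hx =>
    hRρs.symm.le.trans_lt (hRmono hρs0 (hsub ⟨hx.1.le, hx.2⟩) hx.1)
  have hR'pos : ∀ x ∈ Ioi (0:ℝ), 0 < R' x := fun x hx => Φ.radicandDeriv_pos hE hJ.ne' hx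
  have hfcont : ContinuousOn f (Icc ρs 1) := ((Φ.continuousOn_radicand E₀ J).mono hsub).sqrt
  have hderiv : ∀ x ∈ Ioo ρs 1, HasDerivAt f (f' x) x := fun x hx =>
    (Φ.hasDerivAt_radicand E₀ J (hρs0.trans hx.1)).sqrt (hRpos x ⟨hx.1, hx.2.le⟩).ne'
  have hf'nonneg : ∀ x ∈ Ioo ρs 1, 0 ≤ f' x := fun x hx =>
    div_nonneg (hR'pos x (hρs0.trans hx.1)).le (mul_nonneg zero_le_two (Real.sqrt_nonneg _))
  have hcv := integral_Icc_deriv_smul_of_deriv_nonneg (g := k) hfcont hderiv hf'nonneg hρs1.le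
  have hf0 : f ρs = 0 := by
    show Real.sqrt (R ρs) = 0
    rw [show R ρs = 0 from hRρs, Real.sqrt_zero]
  have hf1 : f 1 = Real.sqrt (1 - J ^ 2) := by simp only [hf, hR, Φ.radicand_one E₀ J]
  rw [hf0, hf1] at hcv
  show Real.arcsin J + J * ∫ ρ in ρs..1, (ρ ^ 2 * Real.sqrt (R ρ))⁻¹ =
    Real.arcsin J + ∫ t in Icc 0 (Real.sqrt (1 - J ^ 2)), k t
  rw [← hcv, integral_Icc_eq_integral_Ioc, intervalIntegral.integral_of_le hρs1.le,
    ← integral_const_mul]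
  congr 1
  refine setIntegral_congr_fun measurableSet_Ioc fun x hx => ?_
  have hx0 : 0 < x := hρs0.trans hx.1
  have hRx : 0 < 1 - 4 * Φ.φ x / E₀ - J ^ 2 / x ^ 2 := hRpos x hx
  have hR'x : 0 < 2 * J ^ 2 / x ^ 3 - 4 * deriv Φ.φ x / E₀ := hR'pos x hx0
  have hsq : 0 < Real.sqrt (1 - 4 * Φ.φ x / E₀ - J ^ 2 / x ^ 2) := Real.sqrt_pos.mpr hRx
  simp only [hk, hf', hf, hR, hR', smul_eq_mul]
  rw [hσ x ⟨hx.1.le, hx.2⟩]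
  generalize Real.sqrt (1 - 4 * Φ.φ x / E₀ - J ^ 2 / x ^ 2) = S at hsq ⊢
  generalize (2 * J ^ 2 / x ^ 3 - 4 * deriv Φ.φ x / E₀) = Q at hR'x ⊢
  field_simp


/-! ### The PSS auxiliary function of the potential at level `s` -/

/-- The level domain `D_s = {r > 0 | 4φ(r)/ℰ₀ < s}` is convex (`φ` is nonincreasing). [folklore] -/
theorem convex_levelDomain (E₀ : ℝ) (hE : 0 < E₀) (s : ℝ) :
    Convex ℝ (Ioi (0 : ℝ) ∩ (fun r => 4 * Φ.φ r / E₀) ⁻¹' Iio s) := by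
  refine Set.OrdConnected.convex ⟨fun x hx y hy z hz => ⟨hx.1.trans_le hz.1, ?_⟩⟩
  have h : Φ.φ z ≤ Φ.φ x := Φ.antitoneOn hx.1 (hx.1.trans_le hz.1) hz.1
  show 4 * Φ.φ z / E₀ < s
  have hx2 : 4 * Φ.φ x / E₀ < s := hx.2
  have : 4 * Φ.φ z / E₀ ≤ 4 * Φ.φ x / E₀ := div_le_div_of_nonneg_right (by linarith) hE.le
  linarith

/-- The level domain `D_s = {r > 0 | 4φ(r)/ℰ₀ < s}` is open (`φ` is continuous on `(0, ∞)`). [folklore] -/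
theorem isOpen_levelDomain (E₀ s : ℝ) :
    IsOpen (Ioi (0 : ℝ) ∩ (fun r => 4 * Φ.φ r / E₀) ⁻¹' Iio s) :=
  ((continuousOn_const.mul Φ.continuousOn_φ).div_const _).isOpen_inter_preimage isOpen_Ioi
    isOpen_Iio

/-- **PSS monotonicity, nonstrict form**: under the PSS condition, for every level `s` the function
`m_s(r) = (2(s - u r) + r (-u' r)) / √(s - u r)`, `u = 4φ/ℰ₀`, is nonincreasing on
`D_s = {r > 0 | u r < s}` (`2a' + r a'' = -(4/ℰ₀)(ρφ'' + 2φ') ≤ 0` for `a = s - u`). [cite: GallagherSaintraymondTexier2012, Part III Ch. 8 §3.1, Lemma 3.1 (proof)] -/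
theorem antitoneOn_pssAux_level (hΦ : Φ.PSSCondition) {E₀ : ℝ} (hE : 0 < E₀) (s : ℝ) :
    AntitoneOn (fun x => (2 * (s - 4 * Φ.φ x / E₀) + x * (-(4 * deriv Φ.φ x / E₀))) /
      Real.sqrt (s - 4 * Φ.φ x / E₀)) (Ioi (0 : ℝ) ∩ (fun r => 4 * Φ.φ r / E₀) ⁻¹' Iio s) := by
  refine antitoneOn_pssAux (a := fun x => s - 4 * Φ.φ x / E₀)
    (a' := fun x => -(4 * deriv Φ.φ x / E₀)) (a'' := fun x => -(4 * deriv (deriv Φ.φ) x / E₀))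
    (Φ.convex_levelDomain E₀ hE s) (Φ.isOpen_levelDomain E₀ s) (fun r hr => hr.1.out.le)
    (fun r hr => sub_pos.mpr hr.2) (fun r hr => ?_) (fun r hr => ?_) (fun r hr => ?_)
  · exact (((Φ.hasDerivAt_φ hr.1).const_mul 4).div_const E₀).const_sub s
  · exact (((Φ.hasDerivAt_deriv_φ hr.1).const_mul 4).div_const E₀).neg
  · have h := Φ.pss_sign hΦ hr.1.out
    have : 2 * -(4 * deriv Φ.φ r / E₀) + r * -(4 * deriv (deriv Φ.φ) r / E₀) =
        -(4 / E₀) * (r * deriv (deriv Φ.φ) r + 2 * deriv Φ.φ r) := by ring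
    rw [this]
    exact mul_nonpos_of_nonpos_of_nonneg (neg_nonpos.mpr (div_nonneg (by norm_num) hE.le)) h

/-- **PSS monotonicity, strict form**: under strict repulsion and the PSS condition, `m_s` is
strictly decreasing on `D_s ∩ (0, 1)` (there `a' = -4φ'/ℰ₀ ≠ 0`). [cite: GallagherSaintraymondTexier2012, Part III Ch. 8 §3.1, Lemma 3.1 (proof)] -/
theorem strictAntiOn_pssAux_level (hΦr : Φ.IsStrictlyRepulsive) (hΦ : Φ.PSSCondition) {E₀ : ℝ}
    (hE : 0 < E₀) (s : ℝ) :
    StrictAntiOn (fun x => (2 * (s - 4 * Φ.φ x / E₀) + x * (-(4 * deriv Φ.φ x / E₀))) /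
      Real.sqrt (s - 4 * Φ.φ x / E₀))
      ((Ioi (0 : ℝ) ∩ (fun r => 4 * Φ.φ r / E₀) ⁻¹' Iio s) ∩ Iio 1) := by
  refine strictAntiOn_pssAux (a := fun x => s - 4 * Φ.φ x / E₀)
    (a' := fun x => -(4 * deriv Φ.φ x / E₀)) (a'' := fun x => -(4 * deriv (deriv Φ.φ) x / E₀))
    ((Φ.convex_levelDomain E₀ hE s).inter (convex_Iio 1))
    ((Φ.isOpen_levelDomain E₀ s).inter isOpen_Iio) (fun r hr => hr.1.1.out)
    (fun r hr => sub_pos.mpr hr.1.2) (fun r hr => ?_) (fun r hr => ?_) (fun r hr => ?_)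
    (fun r hr => ?_)
  · exact (((Φ.hasDerivAt_φ hr.1.1).const_mul 4).div_const E₀).const_sub s
  · exact (((Φ.hasDerivAt_deriv_φ hr.1.1).const_mul 4).div_const E₀).neg
  · have h := Φ.pss_sign hΦ hr.1.1.out
    have : 2 * -(4 * deriv Φ.φ r / E₀) + r * -(4 * deriv (deriv Φ.φ) r / E₀) =
        -(4 / E₀) * (r * deriv (deriv Φ.φ) r + 2 * deriv Φ.φ r) := by ring
    rw [this]
    exact mul_nonpos_of_nonpos_of_nonneg (neg_nonpos.mpr (div_nonneg (by norm_num) hE.le)) h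
  · have h := hΦr.deriv_neg ⟨hr.1.1.out, hr.2⟩
    have : -(4 * deriv Φ.φ r / E₀) = (4 / E₀) * (-deriv Φ.φ r) := by ring
    rw [this]
    exact (mul_pos (div_pos (by norm_num) hE) (neg_pos.mpr h)).ne'

/-- At `r = 1` (edge of the range, `φ(1) = φ'(1) = 0`) the PSS auxiliary function is
`m_s(1) = 2√s` (for `s ≤ 0` both sides are the junk value `0`). [folklore] -/
theorem pssAux_level_one {E₀ : ℝ} (s : ℝ) :
    (2 * (s - 4 * Φ.φ 1 / E₀) + 1 * (-(4 * deriv Φ.φ 1 / E₀))) / Real.sqrt (s - 4 * Φ.φ 1 / E₀) =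
      2 * Real.sqrt s := by
  rw [Φ.eq_zero_of_one_le 1 le_rfl, Φ.deriv_φ_eq_zero_of_one_le le_rfl]
  simp only [mul_zero, zero_div, sub_zero, neg_zero, add_zero]
  rcases le_or_gt s 0 with hs | hs
  · rw [Real.sqrt_eq_zero'.mpr hs]; simp
  · rw [div_eq_iff (Real.sqrt_pos.mpr hs).ne']
    rw [mul_assoc, Real.mul_self_sqrt hs.le]

/-- **Level form of the substituted integrand**: if `s - 4φ(ρ)/ℰ₀ = J²/ρ²` (i.e. `ρ` is the radius
at which `sin² ϕ = s` for the impact parameter `J`), then `2J/(ρ² R_J'(ρ)) = 2 / m_s(ρ)`. [folklore] -/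
theorem kernel_eq_two_div_pssAux {E₀ J s ρ : ℝ} (hE : 0 < E₀) (hJ : 0 < J) (hρ : 0 < ρ)
    (hlev : s - 4 * Φ.φ ρ / E₀ = J ^ 2 / ρ ^ 2) :
    2 * J / (ρ ^ 2 * (2 * J ^ 2 / ρ ^ 3 - 4 * deriv Φ.φ ρ / E₀)) =
      2 / ((2 * (s - 4 * Φ.φ ρ / E₀) + ρ * (-(4 * deriv Φ.φ ρ / E₀))) /
        Real.sqrt (s - 4 * Φ.φ ρ / E₀)) := by
  have hQ : 0 < 2 * J ^ 2 / ρ ^ 3 - 4 * deriv Φ.φ ρ / E₀ := Φ.radicandDeriv_pos hE hJ.ne' hρ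
  have hsqrt : Real.sqrt (J ^ 2 / ρ ^ 2) = J / ρ := by
    rw [show J ^ 2 / ρ ^ 2 = (J / ρ) ^ 2 by ring, Real.sqrt_sq (div_pos hJ hρ).le]
  have key : 2 * (J ^ 2 / ρ ^ 2) + ρ * (-(4 * deriv Φ.φ ρ / E₀)) =
      ρ * (2 * J ^ 2 / ρ ^ 3 - 4 * deriv Φ.φ ρ / E₀) := by
    field_simp
    ring
  rw [hlev, hsqrt, key]
  generalize (2 * J ^ 2 / ρ ^ 3 - 4 * deriv Φ.φ ρ / E₀) = Q at hQ ⊢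
  field_simp

/-- **Bounds on the substituted integrand**: under the PSS condition, at a radius `ρ ∈ (0, 1]` of
level `s` for the impact parameter `J > 0`, `0 < 2J/(ρ² R_J'(ρ)) ≤ 1/√s` (from `m_s(ρ) ≥ m_s(1) =
2√s`; with `s = 1 - t²` the bound is the free integrand `1/√(1 - t²)`, i.e. `Θ ≤ π/2`). [cite: GallagherSaintraymondTexier2012, Part III Ch. 8 §3.1, Lemma 3.1] -/
theorem kernel_pos_le (hΦ : Φ.PSSCondition) {E₀ J s ρ : ℝ} (hE : 0 < E₀) (hJ : 0 < J)
    (hρ : 0 < ρ) (hρ1 : ρ ≤ 1) (hlev : s - 4 * Φ.φ ρ / E₀ = J ^ 2 / ρ ^ 2) :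
    0 < 2 * J / (ρ ^ 2 * (2 * J ^ 2 / ρ ^ 3 - 4 * deriv Φ.φ ρ / E₀)) ∧
      2 * J / (ρ ^ 2 * (2 * J ^ 2 / ρ ^ 3 - 4 * deriv Φ.φ ρ / E₀)) ≤ 1 / Real.sqrt s := by
  have hlevpos : 0 < J ^ 2 / ρ ^ 2 := by positivity
  have hs : 0 < s := by
    have : 0 ≤ 4 * Φ.φ ρ / E₀ := div_nonneg (by linarith [Φ.nonneg ρ]) hE.le
    linarith
  have hρD : ρ ∈ Ioi (0 : ℝ) ∩ (fun r => 4 * Φ.φ r / E₀) ⁻¹' Iio s :=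
    ⟨mem_Ioi.mpr hρ, show 4 * Φ.φ ρ / E₀ < s by linarith⟩
  have h1D : (1 : ℝ) ∈ Ioi (0 : ℝ) ∩ (fun r => 4 * Φ.φ r / E₀) ⁻¹' Iio s :=
    ⟨mem_Ioi.mpr zero_lt_one,
      show 4 * Φ.φ 1 / E₀ < s by rw [Φ.eq_zero_of_one_le 1 le_rfl]; simpa using hs⟩
  have hanti := Φ.antitoneOn_pssAux_level hΦ hE s hρD h1D hρ1
  simp only [] at hanti
  rw [Φ.pssAux_level_one s] at hanti
  rw [Φ.kernel_eq_two_div_pssAux hE hJ hρ hlev]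
  have h2s : 0 < 2 * Real.sqrt s := mul_pos two_pos (Real.sqrt_pos.mpr hs)
  generalize (2 * (s - 4 * Φ.φ ρ / E₀) + ρ * (-(4 * deriv Φ.φ ρ / E₀))) /
      Real.sqrt (s - 4 * Φ.φ ρ / E₀) = m at hanti ⊢
  have hm : 0 < m := h2s.trans_le hanti
  refine ⟨div_pos two_pos hm, ?_⟩
  calc 2 / m ≤ 2 / (2 * Real.sqrt s) := div_le_div_of_nonneg_left zero_le_two h2s hanti
    _ = 1 / Real.sqrt s := by field_simp


/-- **Pointwise monotonicity in the impact parameter**: under strict repulsion and the PSS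
condition, if `0 < ρ₁ < ρ₂ < 1` are radii of the same level `s` for impact parameters `J₁, J₂ > 0`,
then `2J₁/(ρ₁² R_{J₁}'(ρ₁)) < 2J₂/(ρ₂² R_{J₂}'(ρ₂))` (both equal `2/m_s(ρᵢ)` and `m_s` is strictly
decreasing) — the pointwise content of `∂Θ/∂𝒥₀ > 0` in GST 2013 Lemma 3.1 / PSS 2014 item 2. [cite: GallagherSaintraymondTexier2012, Part III Ch. 8 §3.1, Lemma 3.1] -/
theorem kernel_lt_kernel (hΦr : Φ.IsStrictlyRepulsive) (hΦ : Φ.PSSCondition)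
    {E₀ J₁ J₂ s ρ₁ ρ₂ : ℝ} (hE : 0 < E₀) (hJ₁ : 0 < J₁) (hJ₂ : 0 < J₂) (hρ₁ : 0 < ρ₁)
    (h12 : ρ₁ < ρ₂) (hρ₂ : ρ₂ < 1) (hlev₁ : s - 4 * Φ.φ ρ₁ / E₀ = J₁ ^ 2 / ρ₁ ^ 2)
    (hlev₂ : s - 4 * Φ.φ ρ₂ / E₀ = J₂ ^ 2 / ρ₂ ^ 2) :
    2 * J₁ / (ρ₁ ^ 2 * (2 * J₁ ^ 2 / ρ₁ ^ 3 - 4 * deriv Φ.φ ρ₁ / E₀)) <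
      2 * J₂ / (ρ₂ ^ 2 * (2 * J₂ ^ 2 / ρ₂ ^ 3 - 4 * deriv Φ.φ ρ₂ / E₀)) := by
  have hρ₂pos : 0 < ρ₂ := hρ₁.trans h12
  have hs : 0 < s := by
    have h1 : 0 < J₁ ^ 2 / ρ₁ ^ 2 := by positivity
    have : 0 ≤ 4 * Φ.φ ρ₁ / E₀ := div_nonneg (by linarith [Φ.nonneg ρ₁]) hE.le
    linarith
  have hρ₁D : ρ₁ ∈ (Ioi (0 : ℝ) ∩ (fun r => 4 * Φ.φ r / E₀) ⁻¹' Iio s) ∩ Iio 1 :=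
    ⟨⟨mem_Ioi.mpr hρ₁, show 4 * Φ.φ ρ₁ / E₀ < s by
      have : 0 < J₁ ^ 2 / ρ₁ ^ 2 := by positivity
      linarith⟩, h12.trans hρ₂⟩
  have hρ₂D : ρ₂ ∈ (Ioi (0 : ℝ) ∩ (fun r => 4 * Φ.φ r / E₀) ⁻¹' Iio s) ∩ Iio 1 :=
    ⟨⟨mem_Ioi.mpr hρ₂pos, show 4 * Φ.φ ρ₂ / E₀ < s by
      have : 0 < J₂ ^ 2 / ρ₂ ^ 2 := by positivity
      linarith⟩, hρ₂⟩
  have h1D : (1 : ℝ) ∈ Ioi (0 : ℝ) ∩ (fun r => 4 * Φ.φ r / E₀) ⁻¹' Iio s :=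
    ⟨mem_Ioi.mpr zero_lt_one,
      show 4 * Φ.φ 1 / E₀ < s by rw [Φ.eq_zero_of_one_le 1 le_rfl]; simpa using hs⟩
  have hlt := Φ.strictAntiOn_pssAux_level hΦr hΦ hE s hρ₁D hρ₂D h12
  have hge := Φ.antitoneOn_pssAux_level hΦ hE s hρ₂D.1 h1D hρ₂.le
  simp only [] at hlt hge
  rw [Φ.pssAux_level_one s] at hge
  rw [Φ.kernel_eq_two_div_pssAux hE hJ₁ hρ₁ hlev₁, Φ.kernel_eq_two_div_pssAux hE hJ₂ hρ₂pos hlev₂]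
  have h2s : 0 < 2 * Real.sqrt s := mul_pos two_pos (Real.sqrt_pos.mpr hs)
  generalize (2 * (s - 4 * Φ.φ ρ₁ / E₀) + ρ₁ * (-(4 * deriv Φ.φ ρ₁ / E₀))) /
      Real.sqrt (s - 4 * Φ.φ ρ₁ / E₀) = m₁ at hlt ⊢
  generalize (2 * (s - 4 * Φ.φ ρ₂ / E₀) + ρ₂ * (-(4 * deriv Φ.φ ρ₂ / E₀))) /
      Real.sqrt (s - 4 * Φ.φ ρ₂ / E₀) = m₂ at hlt hge ⊢
  exact div_lt_div_of_pos_left two_pos (h2s.trans_le hge) hlt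

/-- The kernel `ρ ↦ 2J/(ρ² R_J'(ρ))` is measurable (`deriv φ` is measurable). [folklore] -/
theorem measurable_kernel (E₀ J : ℝ) :
    Measurable (fun ρ : ℝ => 2 * J / (ρ ^ 2 * (2 * J ^ 2 / ρ ^ 3 - 4 * deriv Φ.φ ρ / E₀))) := by
  have h : Measurable (deriv Φ.φ) := measurable_deriv Φ.φ
  exact measurable_const.div ((measurable_id.pow_const 2).mul
    ((measurable_const.div (measurable_id.pow_const 3)).sub ((measurable_const.mul h).div_const _)))

/-- **Integrability of the substituted integrand**: for `σ` as in `exists_inverse_sqrt_radicand`,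
`t ↦ 2J/(σ(t)² R_J'(σ t))` is integrable on `[0, √(1-J²)]` (it is measurable as a measurable
function of the monotone `σ`, and bounded by `1/J` on `(0, √(1-J²))`), and on `(0, √(1-J²))` it is
positive and at most `1/√(1 - t²)`. [folklore] -/
theorem kernel_integrableOn (hΦ : Φ.PSSCondition) {E₀ J : ℝ} (hE : 0 < E₀) (hJ : 0 < J)
    (hJ1 : J < 1) {σ : ℝ → ℝ} (hσmono : MonotoneOn σ (Icc 0 (Real.sqrt (1 - J ^ 2))))
    (hσ : ∀ t ∈ Ioo 0 (Real.sqrt (1 - J ^ 2)), σ t ∈ Ioo (Φ.turningRadius E₀ J) 1 ∧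
        1 - 4 * Φ.φ (σ t) / E₀ - J ^ 2 / σ t ^ 2 = t ^ 2) :
    IntegrableOn
      (fun t => 2 * J / (σ t ^ 2 * (2 * J ^ 2 / σ t ^ 3 - 4 * deriv Φ.φ (σ t) / E₀)))
      (Icc 0 (Real.sqrt (1 - J ^ 2))) ∧
    ∀ t ∈ Ioo 0 (Real.sqrt (1 - J ^ 2)),
      0 < 2 * J / (σ t ^ 2 * (2 * J ^ 2 / σ t ^ 3 - 4 * deriv Φ.φ (σ t) / E₀)) ∧
      2 * J / (σ t ^ 2 * (2 * J ^ 2 / σ t ^ 3 - 4 * deriv Φ.φ (σ t) / E₀)) ≤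
        1 / Real.sqrt (1 - t ^ 2) := by
  obtain ⟨ρs, hts, hJρs, hρs1, hRρs⟩ := Φ.turningRadius_spec hE hJ hJ1
  rw [hts] at hσ
  have hρs0 : 0 < ρs := hJ.trans_le hJρs
  have hbound : ∀ t ∈ Ioo 0 (Real.sqrt (1 - J ^ 2)),
      0 < 2 * J / (σ t ^ 2 * (2 * J ^ 2 / σ t ^ 3 - 4 * deriv Φ.φ (σ t) / E₀)) ∧
      2 * J / (σ t ^ 2 * (2 * J ^ 2 / σ t ^ 3 - 4 * deriv Φ.φ (σ t) / E₀)) ≤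
        1 / Real.sqrt (1 - t ^ 2) := by
    intro t ht
    obtain ⟨hmem, hlev⟩ := hσ t ht
    exact Φ.kernel_pos_le hΦ hE hJ (hρs0.trans hmem.1) hmem.2.le (by linarith)
  refine ⟨?_, hbound⟩
  rw [integrableOn_Icc_iff_integrableOn_Ioo]
  have hmeas : AEStronglyMeasurable
      (fun t => 2 * J / (σ t ^ 2 * (2 * J ^ 2 / σ t ^ 3 - 4 * deriv Φ.φ (σ t) / E₀)))
      (volume.restrict (Ioo 0 (Real.sqrt (1 - J ^ 2)))) :=
    ((Φ.measurable_kernel E₀ J).comp_aemeasurable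
      (aemeasurable_restrict_of_monotoneOn measurableSet_Ioo
        (hσmono.mono Ioo_subset_Icc_self))).aestronglyMeasurable
  refine Integrable.mono' (g := fun _ => 1 / J)
    (integrableOn_const (C := 1 / J) (hs := measure_Ioo_lt_top.ne)) hmeas ?_
  rw [ae_restrict_iff' measurableSet_Ioo]
  refine ae_of_all _ fun t ht => ?_
  obtain ⟨hpos, hle⟩ := hbound t ht
  rw [Real.norm_eq_abs, abs_of_pos hpos]
  refine hle.trans (one_div_le_one_div_of_le hJ ?_)
  rw [Real.le_sqrt' hJ]
  have ht2 : t ^ 2 < 1 - J ^ 2 := by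
    have h := ht.2
    rw [Real.lt_sqrt ht.1.le] at h
    exact h
  linarith


/-- `∫_a^b dt/√(1 - t²) = arcsin b - arcsin a` for `-1 < a ≤ b < 1` (fundamental theorem of
calculus with `Real.hasDerivAt_arcsin`). [folklore] -/
theorem intervalIntegral_one_div_sqrt_one_sub_sq {a b : ℝ} (ha : -1 < a) (hab : a ≤ b)
    (hb : b < 1) :
    ∫ t in a..b, 1 / Real.sqrt (1 - t ^ 2) = Real.arcsin b - Real.arcsin a := by
  apply intervalIntegral.integral_eq_sub_of_hasDerivAt
  · intro x hx
    rw [uIcc_of_le hab] at hx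
    exact Real.hasDerivAt_arcsin (by linarith [hx.1]) (by linarith [hx.2])
  · apply ContinuousOn.intervalIntegrable
    rw [uIcc_of_le hab]
    refine continuousOn_const.div (by fun_prop) fun x hx => ?_
    have : 0 < 1 - x ^ 2 := by nlinarith [hx.1, hx.2]
    exact (Real.sqrt_pos.mpr this).ne'

/-- **Discharge of `Literature.Analysis.FunctionSpaces.ShortRangePotential.strictMonoOn_halfDeflection`**
(GST 2013 Part III Ch. 8 Lemma 3.1, "due to [PSS]"; PSS 2014 Appendix item 2): for a strictly
repulsive short-range potential satisfying `ρ φ'' + 2 φ' ≥ 0` on `(0, 1)` and every `ℰ₀ > 0`, the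
half-deflection `𝒥₀ ↦ Θ(ℰ₀, 𝒥₀)` is strictly increasing on `[0, 1)`. Proof: module docstring
(substitution `t = √(R_J ρ)`, pointwise comparison of the substituted integrands at equal level,
`arcsin J₂ - arcsin J₁ = ∫_{T₂}^{T₁} dt/√(1-t²)`; `Θ(ℰ₀, 0) = 0 < arcsin J₂ ≤ Θ(ℰ₀, J₂)` for `J₁ = 0`).
[cite: GallagherSaintraymondTexier2012, Part III Ch. 8 §3.1, Lemma 3.1 (EMS ed. Lemma 8.3.1)] -/
theorem strictMonoOn_halfDeflection_holds : Φ.strictMonoOn_halfDeflection := by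
  intro hΦr hΦ E₀ hE J₁ hJ₁ J₂ hJ₂ h12
  have hJ₂pos : 0 < J₂ := hJ₁.1.trans_lt h12
  obtain ⟨σ₂, hσ₂mono, hσ₂left, hσ₂⟩ := Φ.exists_inverse_sqrt_radicand hE hJ₂pos hJ₂.2
  have hΘ₂ := Φ.halfDeflection_eq_integral hE hJ₂pos hJ₂.2 hσ₂left
  obtain ⟨hint₂, hbd₂⟩ := Φ.kernel_integrableOn hΦ hE hJ₂pos hJ₂.2 hσ₂mono hσ₂
  set T₂ := Real.sqrt (1 - J₂ ^ 2) with hT₂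
  set k₂ : ℝ → ℝ := fun t =>
    2 * J₂ / (σ₂ t ^ 2 * (2 * J₂ ^ 2 / σ₂ t ^ 3 - 4 * deriv Φ.φ (σ₂ t) / E₀)) with hk₂
  have h1J₂ : 0 < 1 - J₂ ^ 2 := by nlinarith [hJ₂.2, hJ₂pos]
  have hT₂pos : 0 < T₂ := Real.sqrt_pos.mpr h1J₂
  have hI₂ : ∫ t in Icc 0 T₂, k₂ t = ∫ t in (0 : ℝ)..T₂, k₂ t := by
    rw [intervalIntegral.integral_of_le hT₂pos.le, integral_Icc_eq_integral_Ioc]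
  rcases hJ₁.1.eq_or_lt with h0 | hJ₁pos
  · -- `J₁ = 0`: `Θ(E₀, 0) = 0 < arcsin J₂ ≤ Θ(E₀, J₂)`
    rw [← h0, halfDeflection_zero, hΘ₂, hI₂]
    have h1 : 0 < Real.arcsin J₂ := Real.arcsin_pos.mpr hJ₂pos
    have h2 : 0 ≤ ∫ t in (0 : ℝ)..T₂, k₂ t := by
      apply intervalIntegral.integral_nonneg_of_ae_restrict hT₂pos.le
      rw [← Measure.restrict_congr_set (Ioo_ae_eq_Icc : Ioo (0 : ℝ) T₂ =ᵐ[volume] Icc 0 T₂),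
        Filter.EventuallyLE, ae_restrict_iff' measurableSet_Ioo]
      exact ae_of_all _ fun t ht => (hbd₂ t ht).1.le
    linarith
  · -- `0 < J₁ < J₂ < 1`
    obtain ⟨σ₁, hσ₁mono, hσ₁left, hσ₁⟩ := Φ.exists_inverse_sqrt_radicand hE hJ₁pos hJ₁.2
    have hΘ₁ := Φ.halfDeflection_eq_integral hE hJ₁pos hJ₁.2 hσ₁left
    obtain ⟨hint₁, hbd₁⟩ := Φ.kernel_integrableOn hΦ hE hJ₁pos hJ₁.2 hσ₁mono hσ₁
    set T₁ := Real.sqrt (1 - J₁ ^ 2) with hT₁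
    set k₁ : ℝ → ℝ := fun t =>
      2 * J₁ / (σ₁ t ^ 2 * (2 * J₁ ^ 2 / σ₁ t ^ 3 - 4 * deriv Φ.φ (σ₁ t) / E₀)) with hk₁
    have h1J₁ : 0 < 1 - J₁ ^ 2 := by nlinarith [hJ₁.2, hJ₁pos]
    have hT₁pos : 0 < T₁ := Real.sqrt_pos.mpr h1J₁
    have hT₁lt : T₁ < 1 := by
      rw [hT₁, Real.sqrt_lt' one_pos]
      nlinarith
    have hT₂₁ : T₂ < T₁ := by
      rw [hT₂, hT₁]
      exact Real.sqrt_lt_sqrt h1J₂.le (by nlinarith)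
    have hI₁ : ∫ t in Icc 0 T₁, k₁ t = ∫ t in (0 : ℝ)..T₁, k₁ t := by
      rw [intervalIntegral.integral_of_le hT₁pos.le, integral_Icc_eq_integral_Ioc]
    have hk₁a : IntervalIntegrable k₁ volume 0 T₂ := by
      refine (hint₁.mono_set ?_).intervalIntegrable
      rw [uIcc_of_le hT₂pos.le]
      exact Icc_subset_Icc le_rfl hT₂₁.le
    have hk₁b : IntervalIntegrable k₁ volume T₂ T₁ := by
      refine (hint₁.mono_set ?_).intervalIntegrable
      rw [uIcc_of_le hT₂₁.le]
      exact Icc_subset_Icc hT₂pos.le le_rfl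
    have hk₂i : IntervalIntegrable k₂ volume 0 T₂ := by
      refine (hint₂.mono_set ?_).intervalIntegrable
      rw [uIcc_of_le hT₂pos.le]
    have harc : ∫ t in T₂..T₁, 1 / Real.sqrt (1 - t ^ 2) = Real.arcsin J₂ - Real.arcsin J₁ := by
      rw [intervalIntegral_one_div_sqrt_one_sub_sq (by linarith) hT₂₁.le hT₁lt, hT₁, hT₂,
        ← Real.arccos_eq_arcsin hJ₁.1, ← Real.arccos_eq_arcsin hJ₂.1,
        Real.arccos_eq_pi_div_two_sub_arcsin, Real.arccos_eq_pi_div_two_sub_arcsin]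
      ring
    have hsplit : ∫ t in (0 : ℝ)..T₁, k₁ t = (∫ t in (0 : ℝ)..T₂, k₁ t) + ∫ t in T₂..T₁, k₁ t :=
      (intervalIntegral.integral_add_adjacent_intervals hk₁a hk₁b).symm
    have hcomp : ∀ t ∈ Ioo 0 T₂, k₁ t < k₂ t := by
      intro t ht
      have ht₁ : t ∈ Ioo 0 T₁ := ⟨ht.1, ht.2.trans hT₂₁⟩
      obtain ⟨hm₁, hlev₁⟩ := hσ₁ t ht₁
      obtain ⟨hm₂, hlev₂⟩ := hσ₂ t ht
      obtain ⟨ρs₁, hts₁, hJρs₁, -, -⟩ := Φ.turningRadius_spec hE hJ₁pos hJ₁.2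
      obtain ⟨ρs₂, hts₂, hJρs₂, -, -⟩ := Φ.turningRadius_spec hE hJ₂pos hJ₂.2
      rw [hts₁] at hm₁
      rw [hts₂] at hm₂
      have hρ₁pos : 0 < σ₁ t := (hJ₁pos.trans_le hJρs₁).trans hm₁.1
      have hρ₂pos : 0 < σ₂ t := (hJ₂pos.trans_le hJρs₂).trans hm₂.1
      have hρ12 : σ₁ t < σ₂ t := by
        have hlt : 1 - 4 * Φ.φ (σ₂ t) / E₀ - J₂ ^ 2 / σ₂ t ^ 2 <
            1 - 4 * Φ.φ (σ₂ t) / E₀ - J₁ ^ 2 / σ₂ t ^ 2 :=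
          Φ.radicand_lt_radicand hJ₁.1 h12 hρ₂pos
        rw [hlev₂, ← hlev₁] at hlt
        exact ((Φ.strictMonoOn_radicand hE hJ₁pos.ne').lt_iff_lt hρ₁pos hρ₂pos).mp hlt
      exact Φ.kernel_lt_kernel (s := 1 - t ^ 2) hΦr hΦ hE hJ₁pos hJ₂pos hρ₁pos hρ12 hm₂.2
        (by linarith) (by linarith)
    have hA : (∫ t in (0 : ℝ)..T₂, k₁ t) < ∫ t in (0 : ℝ)..T₂, k₂ t := by
      have := intervalIntegral.intervalIntegral_pos_of_pos_on (hk₂i.sub hk₁a)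
        (fun t ht => sub_pos.mpr (hcomp t ht)) hT₂pos
      rw [intervalIntegral.integral_sub hk₂i hk₁a] at this
      linarith
    have hB : (∫ t in T₂..T₁, k₁ t) ≤ ∫ t in T₂..T₁, 1 / Real.sqrt (1 - t ^ 2) := by
      refine intervalIntegral.integral_mono_on_of_le_Ioo hT₂₁.le hk₁b ?_ fun t ht => ?_
      · apply ContinuousOn.intervalIntegrable
        rw [uIcc_of_le hT₂₁.le]
        refine continuousOn_const.div (by fun_prop) fun x hx => ?_
        have : 0 < 1 - x ^ 2 := by nlinarith [hx.1, hx.2, hT₂pos, hT₁lt]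
        exact (Real.sqrt_pos.mpr this).ne'
      · exact (hbd₁ t ⟨hT₂pos.trans ht.1, ht.2⟩).2
    rw [hΘ₁, hΘ₂, hI₁, hI₂, hsplit]
    linarith

/-- **Monotone deflection under the PSS condition, reduced to the deflection formula**: with
`strictMonoOn_halfDeflection` discharged, the conditional fact
`hasMonotoneDeflection_of_pssCondition` only depends on the named fact
`deflectionAngle_eq_pi_sub_two_mul_halfDeflection` (GST 2013 Ch. 8 §1/§3.1, `χ = π - 2Θ`). [cite: GallagherSaintraymondTexier2012, Part III Ch. 8 §3.1 (paragraph after Remark 3.2)] -/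
theorem hasMonotoneDeflection_of_pssCondition_of' [Fintype d]
    (h₁ : Φ.deflectionAngle_eq_pi_sub_two_mul_halfDeflection) :
    Φ.hasMonotoneDeflection_of_pssCondition :=
  hasMonotoneDeflection_of_pssCondition_of h₁ Φ.strictMonoOn_halfDeflection_holds

/-- A strictly repulsive short-range potential satisfying the PSS condition has monotone
deflection, granted the deflection formula `χ = π - 2Θ(|w|², |ρ|)`
(`deflectionAngle_eq_pi_sub_two_mul_halfDeflection`); the monotonicity of `Θ` is now proved. [cite: GallagherSaintraymondTexier2012, Part III Ch. 8 §3.1, Lemma 3.1 & Remark 3.2] -/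
theorem HasMonotoneDeflection.of_pssCondition' [Fintype d]
    (h₁ : Φ.deflectionAngle_eq_pi_sub_two_mul_halfDeflection) (hΦ : Φ.IsStrictlyRepulsive)
    (hΦ' : Φ.PSSCondition) : Φ.HasMonotoneDeflection :=
  HasMonotoneDeflection.of_pssCondition h₁ Φ.strictMonoOn_halfDeflection_holds hΦ hΦ'

end ShortRangePotential

end Literature.Analysis.FunctionSpaces
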